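import Literature.Probability.RandomPlanarGeometry.HexSAWHexagonSurgery
import Literature.Probability.RandomPlanarGeometry.SAWKestenInequalityAbstract
import Literature.Probability.RandomPlanarGeometry.HexSAWRatioEngine
import HarnessLib

/-!
# Kesten's two-step ratio inequality on the hexagonal lattice from the transfer counts («HEX-RATIO-2», block E-ℍ)

Topic `Literature/Probability/RandomPlanarGeometry`. Source: N. Madras, G. Slade, *The Self-Avoiding Walk* (1993),
§7.3, Lemma 7.3.1 (p. 242) and Theorem 7.3.2 (p. 244, (7.3.5)–(7.3.11)): the pattern pair `U` = two consecutive
edges of a hexagon, `V` = the other four (`|V| = |U| + 2`), on `ℍ`. This file is block E-ℍ of the lane's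
«HEX-RATIO-2» partition (lead g8 r58/r64): the abstract assembly `kesten_ineq_of_transfer`
(`SAWKestenInequalityAbstract.lean`, block C) instantiated ALONG EACH PARITY CLASS `N = 2m + δ` on the walks
`S_m := sawFin hvOrigin (2m + δ)` of `ℍ` with the surgery vocabulary of `HexSAWHexagonSurgery.lean` (a-p5 g5:
`hexSlots` = insertion sites `I`, `hexSharp` = deletion sites `J`), consuming the three transfer/density inputs
IN THEIR FROZEN FACE SHAPES —

* (P1-ℍ) `#{ω' ∈ S_{N+2} : J ω' ≥ 1} ≤ Σ_{ω ∈ S_N} I ω / max (J ω − 24) 1` (`hexKesten_P1'`, a-p2);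
* (P2-ℍ) `Σ_{ω ∈ S_N} I ω · max 0 (I ω − 324) / ((J ω + 24)(J ω + 48)) ≤ c_{N+4}` (`hexKesten_P2`, a-p2);
* (P3-ℍ) per parity `δ ≤ 1`: `∃ a > 0, ∃ C ≥ 0, ∀ m ≥ 1, #{ω ∈ S_{2m+δ} : J ω < a m} ≤ C #S_{2m+δ} / m³`
  (`hexKesten_P3_of … δ hδ`, a-idea-1's D-ℍ adapter fed with K1′-ℍ `DetourDensityHex`);

merged over the two parities by `kestenIneqTwo_of_parity` (`HexSAWRatioEngine.lean`) into the face
**`KestenIneqHex`**: `∃ D, ∀ᶠ N, φ_N² − D/N ≤ φ_N φ_{N+2}`, `φ_N = c_{N+2}(ℍ)/c_N(ℍ)`.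
Constants adapter: `c₁ = 24`, `c₂ = 324`, `c₃ = 47` (termwise `(J+47)(J+48) ≥ (J+24)(J+48)`, negative summands
only help), `c₄ = 81` (`I ≤ 27(|ω| − 2) ≤ 81 m` on `S_{2m+δ}`, `card_hexSlots_le`), `B = c_2(ℍ)`
(`c_{M+2} ≤ c_M c_2`, `hexSawCount_add_le`), `N₁ = 1`.
-/

noncomputable section

open Finset Filter Topology
open Literature.Probability.LatticeModels Literature.Probability.Percolation SimpleGraph

namespace Literature.Probability.RandomPlanarGeometry.SAW.HV

/-- `#S_n(ℍ) = c_n(ℍ)` (the tree's `hexSawCount_eq_card`, oriented for rewriting). [cite: MadrasSlade1993, §1.1] -/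
theorem card_sawFin_hvOrigin (n : ℕ) : #(sawFin hvOrigin n) = hexSawCount n := (hexSawCount_eq_card n).symm

/-- **Block E-ℍ along one parity class** `N = 2m + δ`: the three transfer/density counts in their frozen face
shapes give Kesten's inequality `φ_M² − D/m ≤ φ_M φ_{M+2}`, `M = 2m + δ`, eventually in `m` — the abstract
assembly `kesten_ineq_of_transfer` with `S m := sawFin hvOrigin (2m + δ)`, `I = #hexSlots`, `J = #hexSharp`.
[cite: MadrasSlade1993, Theorem 7.3.2 (proof, (7.3.5)–(7.3.11))] -/
theorem kestenIneqHex_parity_of_transfer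
    (hP1 : ∀ N : ℕ, (#((sawFin hvOrigin (N + 2)).filter fun ω' => 1 ≤ #(hexSharp ω')) : ℝ) ≤
      ∑ ω ∈ sawFin hvOrigin N, (#(hexSlots ω) : ℝ) / max ((#(hexSharp ω) : ℝ) - 24) 1)
    (hP2 : ∀ N : ℕ, ∑ ω ∈ sawFin hvOrigin N, (#(hexSlots ω) : ℝ) * max 0 ((#(hexSlots ω) : ℝ) - 324) /
        (((#(hexSharp ω) : ℝ) + 24) * ((#(hexSharp ω) : ℝ) + 48)) ≤ (hexSawCount (N + 4) : ℝ))
    {δ : ℕ} (hδ : δ ≤ 1)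
    (hP3 : ∃ a > (0 : ℝ), ∃ C ≥ (0 : ℝ), ∀ m ≥ (1 : ℕ),
      (#((sawFin hvOrigin (2 * m + δ)).filter fun ω => ((#(hexSharp ω) : ℕ) : ℝ) < a * m) : ℝ) ≤
        C * #(sawFin hvOrigin (2 * m + δ)) / (m : ℝ) ^ 3) :
    ∃ D : ℝ, ∀ᶠ m : ℕ in atTop,
      ((hexSawCount (2 * m + δ + 2) : ℝ) / hexSawCount (2 * m + δ)) ^ 2 - D / m ≤
        ((hexSawCount (2 * m + δ + 2) : ℝ) / hexSawCount (2 * m + δ)) *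
          ((hexSawCount (2 * m + δ + 2 + 2) : ℝ) / hexSawCount (2 * m + δ + 2)) := by
  obtain ⟨a, ha, C, hC0, hC⟩ := hP3
  have hidx1 : ∀ m : ℕ, 2 * (m + 1) + δ = 2 * m + δ + 2 := fun m => by ring
  have hidx2 : ∀ m : ℕ, 2 * (m + 2) + δ = 2 * m + δ + 2 + 2 := fun m => by ring
  -- instantiate the abstract assembly along the parity class
  have key := kesten_ineq_of_transfer (α := List HV) (fun m => sawFin hvOrigin (2 * m + δ))
    (fun _ ω => #(hexSlots ω)) (fun _ ω => #(hexSharp ω)) 1 (a := a) (B := hexSawCount 2) (C := C)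
    (c₁ := 24) (c₂ := 324) (c₃ := 47) (c₄ := 81) ha (Nat.cast_nonneg _) hC0 (by norm_num) (by norm_num)
    (by norm_num) (by norm_num)
    (fun m _ => by rw [card_sawFin_hvOrigin]; exact hexSawCount_pos _)
    (fun m _ => by
      simp only [hidx1, card_sawFin_hvOrigin]
      have h := hexSawCount_add_le (2 * m + δ) 2
      calc ((hexSawCount (2 * m + δ + 2) : ℕ) : ℝ) ≤ ((hexSawCount (2 * m + δ) * hexSawCount 2 : ℕ) : ℝ) := by
            exact_mod_cast h
        _ = (hexSawCount 2 : ℝ) * hexSawCount (2 * m + δ) := by push_cast; ring)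
    (fun m hm ω hω => by
      have h := card_hexSlots_le (ω := ω)
      have hl := length_of_mem_sawFin hω
      have h' : #(hexSlots ω) ≤ 81 * m := by rw [hl] at h; clear hω; omega
      calc ((#(hexSlots ω) : ℕ) : ℝ) ≤ ((81 * m : ℕ) : ℝ) := by exact_mod_cast h'
        _ = 81 * (m : ℝ) := by push_cast; ring)
    (fun m _ => by simp only [hidx1]; exact hP1 (2 * m + δ))
    (fun m _ => by
      -- (P2-ℍ): termwise `I(I−324)/((J+47)(J+48)) ≤ I·max 0 (I−324)/((J+24)(J+48))`
      simp only [hidx2, card_sawFin_hvOrigin]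
      refine le_trans (sum_le_sum fun ω _ => ?_) (hP2 (2 * m + δ))
      set I : ℝ := (#(hexSlots ω) : ℝ)
      set J : ℝ := (#(hexSharp ω) : ℝ)
      have hI0 : 0 ≤ I := Nat.cast_nonneg _
      have hJ0 : 0 ≤ J := Nat.cast_nonneg _
      have hden : 0 < (J + 24) * (J + 48) := by positivity
      have hden' : 0 < (J + 47) * (J + 47 + 1) := by positivity
      by_cases h324 : 324 ≤ I
      · have hmax : max 0 (I - 324) = I - 324 := max_eq_right (by linarith)
        rw [hmax]
        apply div_le_div_of_nonneg_left (by nlinarith) hden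
        nlinarith
      · have hneg : I * (I - 324) / ((J + 47) * (J + 47 + 1)) ≤ 0 :=
          div_nonpos_of_nonpos_of_nonneg (by nlinarith) hden'.le
        have hpos : 0 ≤ I * max 0 (I - 324) / ((J + 24) * (J + 48)) := by positivity
        linarith)
    (fun m _ hm => hC m hm)
  -- read off the parity-class inequality
  obtain ⟨D, hD⟩ := key
  refine ⟨D, ?_⟩
  filter_upwards [hD] with m h
  simpa only [hidx1, hidx2, card_sawFin_hvOrigin] using h

/-- **Block E-ℍ, hypothesis form**: the transfer counts (P1-ℍ), (P2-ℍ) and the per-parity density bound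
(P3-ℍ), in their frozen face shapes, imply the face `KestenIneqHex` (the two parity classes merged by
`kestenIneqTwo_of_parity`). [cite: MadrasSlade1993, Theorem 7.3.2 (proof) and Lemma 7.3.1 (7.3.1)] -/
theorem kestenIneqHex_of_transfer
    (hP1 : ∀ N : ℕ, (#((sawFin hvOrigin (N + 2)).filter fun ω' => 1 ≤ #(hexSharp ω')) : ℝ) ≤
      ∑ ω ∈ sawFin hvOrigin N, (#(hexSlots ω) : ℝ) / max ((#(hexSharp ω) : ℝ) - 24) 1)
    (hP2 : ∀ N : ℕ, ∑ ω ∈ sawFin hvOrigin N, (#(hexSlots ω) : ℝ) * max 0 ((#(hexSlots ω) : ℝ) - 324) /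
        (((#(hexSharp ω) : ℝ) + 24) * ((#(hexSharp ω) : ℝ) + 48)) ≤ (hexSawCount (N + 4) : ℝ))
    (hP3 : ∀ δ : ℕ, δ ≤ 1 → ∃ a > (0 : ℝ), ∃ C ≥ (0 : ℝ), ∀ m ≥ (1 : ℕ),
      (#((sawFin hvOrigin (2 * m + δ)).filter fun ω => ((#(hexSharp ω) : ℕ) : ℝ) < a * m) : ℝ) ≤
        C * #(sawFin hvOrigin (2 * m + δ)) / (m : ℝ) ^ 3) :
    KestenIneqHex :=
  kestenIneqTwo_of_parity (φ := fun N => (hexSawCount (N + 2) : ℝ) / hexSawCount N) fun δ hδ =>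
    kestenIneqHex_parity_of_transfer hP1 hP2 hδ (hP3 δ hδ)

/-- **HEX-RATIO-2 modulo its inputs**: (K3-ℍ) `c_N ≤ c_{N+4}` and the three transfer/density counts give
`c_{N+2}(ℍ)/c_N(ℍ) → 2 + √2 = μ(ℍ)²` (`hexRatioTwo_of`, Madras–Slade Lemma 7.3.1 with Duminil-Copin–Smirnov's
value of `μ(ℍ)`). [cite: MadrasSlade1993, Lemma 7.3.1 and Theorem 7.3.4 (a); DuminilCopinSmirnov2012, Theorem 1] -/
theorem hexRatioTwo_of_transfer (h3 : ∀ N : ℕ, hexSawCount N ≤ hexSawCount (N + 4))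
    (hP1 : ∀ N : ℕ, (#((sawFin hvOrigin (N + 2)).filter fun ω' => 1 ≤ #(hexSharp ω')) : ℝ) ≤
      ∑ ω ∈ sawFin hvOrigin N, (#(hexSlots ω) : ℝ) / max ((#(hexSharp ω) : ℝ) - 24) 1)
    (hP2 : ∀ N : ℕ, ∑ ω ∈ sawFin hvOrigin N, (#(hexSlots ω) : ℝ) * max 0 ((#(hexSlots ω) : ℝ) - 324) /
        (((#(hexSharp ω) : ℝ) + 24) * ((#(hexSharp ω) : ℝ) + 48)) ≤ (hexSawCount (N + 4) : ℝ))
    (hP3 : ∀ δ : ℕ, δ ≤ 1 → ∃ a > (0 : ℝ), ∃ C ≥ (0 : ℝ), ∀ m ≥ (1 : ℕ),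
      (#((sawFin hvOrigin (2 * m + δ)).filter fun ω => ((#(hexSharp ω) : ℕ) : ℝ) < a * m) : ℝ) ≤
        C * #(sawFin hvOrigin (2 * m + δ)) / (m : ℝ) ^ 3) :
    Tendsto (fun N : ℕ => (hexSawCount (N + 2) : ℝ) / hexSawCount N) atTop (𝓝 (2 + Real.sqrt 2)) :=
  hexRatioTwo_of h3 (kestenIneqHex_of_transfer hP1 hP2 hP3)

end Literature.Probability.RandomPlanarGeometry.SAW.HV

end
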